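import Summits.BirchSwinnertonDyer.BirchSwinnertonDyer.Theorems.ByReductionTypeAtTwoFineSelmerConjAAtTwoAdditivePotGoodGenusDoorSignature
import Summits.BirchSwinnertonDyer.BirchSwinnertonDyer.Theorems.ByReductionTypeAtTwoFineSelmerConjAAtTwoAdditivePotGoodClassNumberOned8372p
import Literature.NumberTheory.NumberFields.CubicFieldUnitSignatureCertificate
import HarnessLib

/-!
# Route `ByReductionTypeAtTwo` (rung K4), crux C1″ `FineSelmerConjAAtTwoAdditivePotGood` (item stmt-BirchSwinnertonDyer-22615):
# GENUS STAMPS, part E (TOTALLY REAL point field) — UNCONDITIONAL (A)₂ for the census DOOR row `301392cf1` (`d = 8372`)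
# by the SIGNATURE genus door and a kernel UNIT-SIGNATURE CERTIFICATE
# (a `--supports 22615` file; seat `bsd-2adic-k4-w1` GEN 8, lane (b) «Δ_cubic > 0 door rows» of pen RC-472/473/475)

HONEST FRAMING (cell `bsd-2adic`, D-0036/D-0054/D-0152): THEOREMS ONLY (no definition, no named fact, no `sorry`); `conjA_two_301392cf1'`
is PROVED OUTRIGHT — statement (A) of Coates–Sujatha at `p = 2` for this ONE curve with no hypothesis and no named fact (the earlier
stamp `conjA_two_301392cf1 hLim2` needed Lim 2017 Thm. 3.5 at `2` at a totally real carrier). Statement (A) is NOT BSD: BSD₂ for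
`301392cf1` is not proved by any of this; C1″ (the `∀`-statement) stays research-open; nothing booked.

MECHANISM (all kernel). The `2`-torsion point field of `301392cf1` is the TOTALLY REAL cubic field `K = ℚ(θ)`, `θ³ − θ² − 299θ + 2093 = 0`
(`d = 8372`, `h = 1` by GEN 6's certificate `classNumber_eq_one_of_root_d8372p`, `2 = 𝔭³`: `θ − 1` is a root of the Eisenstein cubic
`X³ + 2X² − 298X + 1794`). Its three real roots lie in `(−19.64435, −19.64434)`, `(10.27122, 10.27123)`, `(10.37311, 10.37312)`
(sign changes, IVT), giving three distinct real embeddings `ρ₀, ρ₁, ρ₂`; the units `u₁ = 201 − 9θ − θ²` (inverse `−1614 + 75θ + 8θ²`)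
and `u₂ = 692 − 129θ + 6θ²` (inverse `193787 − 8817θ − 951θ²`) have signs `(−,+,+)` and `(+,+,−)` at `(ρ₀, ρ₁, ρ₂)` (endpoint test of
`CubicFieldUnitSignatureCertificate`; note `u₂(ρ₁) ≈ 3.5·10⁻⁴`, `u₁(ρ₂) ≈ 4·10⁻²`), so with `−1` the unit signature map is ONTO
(`signVec_surjective_of_two_units`), and the signature genus door `conjA_two_of_genus_adjoin_root_of_signVec_surjective`
(`…GenusDoorSignature`: Chevalley WITH SIGNATURES on `ℚ(θ, √−1)/ℚ(θ)`, p724470, Iwasawa 1956, w2's door p718233) gives (A)₂.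
(The other totally real door row, `100560c1` (`d = 1257`), has unit signature rank `2` — `θ² − 2` is a totally positive non-square
unit and a norm from `K(i)` — so `h(K(i))` is even and this road is closed for it; it keeps `conjA_two_100560c1 hLim2`.)

References: [CoatesSujatha2005] Conj. A, Thm. 3.4; [Greenberg2001IwasawaPastPresent] Prop. 2.1; [FrohlichTaylor1990] Ch. V §1;
[Cohen1993] §4.1.3, App. B; tree p718233, p722472, p724470, and this seat's `…GenusDoorSignature`, `CubicFieldUnitSignatureCertificate`.
-/

set_option autoImplicit false
-- sibling precedent (`…GenusDoorCubic.lean`): the directory name repeats the summit name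
set_option linter.dupNamespace false

noncomputable section

open scoped Classical IntermediateField NumberField

namespace Summit.BirchSwinnertonDyer.BirchSwinnertonDyer.Theorems.AddKatoTwo

open WeierstrassCurve Field Polynomial IsDedekindDomain NumberField Literature.NumberTheory.EllipticCurves
  Literature.NumberTheory.GaloisRepresentations
  Literature.NumberTheory.IwasawaTheory Literature.NumberTheory.NumberFields
  Literature.Geometry.Kaehler.ComplexTorus
  Summit.BirchSwinnertonDyer.BirchSwinnertonDyer.Theorems.AlignedTransportAtTwoTorsionPointField
  Summit.BirchSwinnertonDyer.BirchSwinnertonDyer.Theses.ByReductionTypeAtTwo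

/-! ## §1 The unit signature certificate of the cubic field `d = 8372` -/

/-- A function on `Fin 3` with pairwise distinct values is injective. [folklore] -/
private theorem injective_fin_three {α : Type*} {f : Fin 3 → α} (h01 : f 0 ≠ f 1) (h02 : f 0 ≠ f 2) (h12 : f 1 ≠ f 2) :
    Function.Injective f := by
  intro a c hac
  fin_cases a <;> fin_cases c
  all_goals first
    | rfl
    | exact absurd hac h01
    | exact absurd hac.symm h01
    | exact absurd hac h02
    | exact absurd hac.symm h02
    | exact absurd hac h12
    | exact absurd hac.symm h12


/-- **The units of the totally real cubic field `ℚ(θ)`, `θ³ − θ² − 299θ + 2093 = 0` (`d = 8372`), take ALL EIGHT signatures** — KERNEL: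
three real roots isolated in `(−19.64435, −19.64434)`, `(10.27122, 10.27123)`, `(10.37311, 10.37312)`; units `u₁ = 201 − 9θ − θ²`,
`u₂ = 692 − 129θ + 6θ²` with sign bits `(1,0,0)`, `(0,0,1)`; `signVec_surjective_of_two_units`.
[cite: FrohlichTaylor1990, Ch. V §1 (1.12), p. 164] [cite: Cohen1993, §4.1.3 and App. B (d = 8372)] -/
theorem signVec_surjective_cubicField_d8372p {θ : AlgebraicClosure ℚ}
    (hθ : aeval θ (Cubic.toPoly ⟨1, ((-1 : ℤ) : ℚ), ((-299 : ℤ) : ℚ), ((2093 : ℤ) : ℚ)⟩) = 0)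
    [NumberField (IntermediateField.adjoin ℚ {θ})] :
    Function.Surjective (signVec (K := ↥(IntermediateField.adjoin ℚ {θ}))) := by
  set K := IntermediateField.adjoin ℚ {θ} with hKdef
  have h3 : Module.finrank ℚ K = 3 := finrank_adjoin_eq_three_of_irreducible irreducible_cubic_d8372p hθ
  -- three real roots
  obtain ⟨x₀, hl₀, hu₀, hx₀⟩ := exists_cubic_root_Ioo_of_neg_of_pos (p := (-1 : ℝ)) (q := -299) (r := 2093)
    (l := -392887 / 20000) (u := -982217 / 50000) (by norm_num) (by norm_num) (by norm_num)
  obtain ⟨x₁, hl₁, hu₁, hx₁⟩ := exists_cubic_root_Ioo_of_pos_of_neg (p := (-1 : ℝ)) (q := -299) (r := 2093)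
    (l := 513561 / 50000) (u := 1027123 / 100000) (by norm_num) (by norm_num) (by norm_num)
  obtain ⟨x₂, hl₂, hu₂, hx₂⟩ := exists_cubic_root_Ioo_of_neg_of_pos (p := (-1 : ℝ)) (q := -299) (r := 2093)
    (l := 1037311 / 100000) (u := 32416 / 3125) (by norm_num) (by norm_num) (by norm_num)
  have haev : ∀ x : ℝ, x ^ 3 + (-1) * x ^ 2 + (-299) * x + 2093 = 0 →
      aeval x (Cubic.toPoly ⟨1, ((-1 : ℤ) : ℚ), ((-299 : ℤ) : ℚ), ((2093 : ℤ) : ℚ)⟩) = 0 := fun x hx => by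
    simp only [Cubic.toPoly, map_one, one_mul, aeval_add, aeval_mul, aeval_C, aeval_X_pow, aeval_X, eq_ratCast,
      Rat.cast_intCast]
    push_cast
    linear_combination hx
  obtain ⟨ρ₀, hρ₀⟩ := exists_ringHom_adjoin_apply_gen_eq (P := ⟨1, ((-1 : ℤ) : ℚ), ((-299 : ℤ) : ℚ), ((2093 : ℤ) : ℚ)⟩) rfl
    irreducible_cubic_d8372p hθ (haev x₀ hx₀)
  obtain ⟨ρ₁, hρ₁⟩ := exists_ringHom_adjoin_apply_gen_eq (P := ⟨1, ((-1 : ℤ) : ℚ), ((-299 : ℤ) : ℚ), ((2093 : ℤ) : ℚ)⟩) rfl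
    irreducible_cubic_d8372p hθ (haev x₁ hx₁)
  obtain ⟨ρ₂, hρ₂⟩ := exists_ringHom_adjoin_apply_gen_eq (P := ⟨1, ((-1 : ℤ) : ℚ), ((-299 : ℤ) : ℚ), ((2093 : ℤ) : ℚ)⟩) rfl
    irreducible_cubic_d8372p hθ (haev x₂ hx₂)
  have hx01 : x₀ ≠ x₁ := by intro h; rw [h] at hu₀; linarith
  have hx02 : x₀ ≠ x₂ := by intro h; rw [h] at hu₀; linarith
  have hx12 : x₁ ≠ x₂ := by intro h; rw [h] at hu₁; linarith
  set ρ : Fin 3 → (K →+* ℝ) := ![ρ₀, ρ₁, ρ₂] with hρdef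
  have hρ0 : ρ 0 = ρ₀ := rfl
  have hρ1 : ρ 1 = ρ₁ := rfl
  have hρ2 : ρ 2 = ρ₂ := rfl
  have hne : ∀ {φ ψ : K →+* ℝ} {a c : ℝ}, φ (IntermediateField.AdjoinSimple.gen ℚ θ) = a →
      ψ (IntermediateField.AdjoinSimple.gen ℚ θ) = c → a ≠ c → φ ≠ ψ := by
    intro φ ψ a c ha hc hac h
    rw [h] at ha
    exact hac (ha.symm.trans hc)
  have hρ : Function.Injective ρ :=
    injective_fin_three (hne hρ₀ hρ₁ hx01) (hne hρ₀ hρ₂ hx02) (hne hρ₁ hρ₂ hx12)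
  -- the two units
  obtain ⟨b, hbθ, hb⟩ := exists_ringOfIntegers_cubic_root (p := -1) (q := -299) (r := 2093) hθ
  have hbgen : algebraMap (𝓞 K) K b = IntermediateField.AdjoinSimple.gen ℚ θ := Subtype.ext hbθ
  have hb' : b ^ 3 + (-1 : 𝓞 K) * b ^ 2 + (-299 : 𝓞 K) * b + (2093 : 𝓞 K) = 0 := by push_cast at hb; exact hb
  set e₁ : (𝓞 K)ˣ := Units.mkOfMulEqOne (201 - 9 * b - b ^ 2) (-1614 + 75 * b + 8 * b ^ 2)
    (by linear_combination (-155 - 8 * b) * hb') with he₁def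
  set e₂ : (𝓞 K)ˣ := Units.mkOfMulEqOne (692 - 129 * b + 6 * b ^ 2) (193787 - 8817 * b - 951 * b ^ 2)
    (by linear_combination (64071 - 5706 * b) * hb') with he₂def
  have he₁ : ((e₁ : 𝓞 K) : K) = ((201 : ℤ) : K) + ((-9 : ℤ) : K) * IntermediateField.AdjoinSimple.gen ℚ θ +
      ((-1 : ℤ) : K) * IntermediateField.AdjoinSimple.gen ℚ θ ^ 2 := by
    rw [he₁def, Units.val_mkOfMulEqOne, NumberField.RingOfIntegers.coe_eq_algebraMap, map_sub, map_sub, map_mul,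
      map_pow, map_ofNat, map_ofNat, hbgen]
    push_cast; ring
  have he₂ : ((e₂ : 𝓞 K) : K) = ((692 : ℤ) : K) + ((-129 : ℤ) : K) * IntermediateField.AdjoinSimple.gen ℚ θ +
      ((6 : ℤ) : K) * IntermediateField.AdjoinSimple.gen ℚ θ ^ 2 := by
    rw [he₂def, Units.val_mkOfMulEqOne, NumberField.RingOfIntegers.coe_eq_algebraMap, map_add, map_sub, map_mul,
      map_mul, map_pow, map_ofNat, map_ofNat, map_ofNat, hbgen]
    push_cast; ring
  -- sign bits at the three embeddings (endpoint tests)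
  have hs₁ : ∀ j, signVec e₁ (ρ j) = ![1, 0, 0] j := by
    intro j; fin_cases j
    · show signVec e₁ ρ₀ = 1
      refine signVec_apply_eq_one_of_neg ρ₀ e₁ hρ₀ he₁ ?_
      have := quadratic_neg_of_endpoints (a₀ := (201 : ℝ)) (a₁ := -9) (a₂ := -1) (m := 8) hl₀.le hu₀.le (by norm_num)
        (by norm_num) (by norm_num) (by norm_num)
      push_cast; linarith
    · show signVec e₁ ρ₁ = 0
      refine signVec_apply_eq_zero_of_pos ρ₁ e₁ hρ₁ he₁ ?_
      have := quadratic_pos_of_endpoints (a₀ := (201 : ℝ)) (a₁ := -9) (a₂ := -1) (m := 3) hl₁.le hu₁.le (by norm_num)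
        (by norm_num) (by norm_num) (by norm_num)
      push_cast; linarith
    · show signVec e₁ ρ₂ = 0
      refine signVec_apply_eq_zero_of_pos ρ₂ e₁ hρ₂ he₁ ?_
      have := quadratic_pos_of_endpoints (a₀ := (201 : ℝ)) (a₁ := -9) (a₂ := -1) (m := 1 / 25) hl₂.le hu₂.le (by norm_num)
        (by norm_num) (by norm_num) (by norm_num)
      push_cast; linarith
  have hs₂ : ∀ j, signVec e₂ (ρ j) = ![0, 0, 1] j := by
    intro j; fin_cases j
    · show signVec e₂ ρ₀ = 0
      refine signVec_apply_eq_zero_of_pos ρ₀ e₂ hρ₀ he₂ ?_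
      have := quadratic_pos_of_endpoints (a₀ := (692 : ℝ)) (a₁ := -129) (a₂ := 6) (m := 5541) hl₀.le hu₀.le (by norm_num)
        (by norm_num) (by norm_num) (by norm_num)
      push_cast; linarith
    · show signVec e₂ ρ₁ = 0
      refine signVec_apply_eq_zero_of_pos ρ₁ e₂ hρ₁ he₂ ?_
      have := quadratic_pos_of_endpoints (a₀ := (692 : ℝ)) (a₁ := -129) (a₂ := 6) (m := 3 / 10000) hl₁.le hu₁.le
        (by norm_num) (by norm_num) (by norm_num) (by norm_num)
      push_cast; linarith
    · show signVec e₂ ρ₂ = 1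
      refine signVec_apply_eq_one_of_neg ρ₂ e₂ hρ₂ he₂ ?_
      have := quadratic_neg_of_endpoints (a₀ := (692 : ℝ)) (a₁ := -129) (a₂ := 6) (m := 1 / 2) hl₂.le hu₂.le (by norm_num)
        (by norm_num) (by norm_num) (by norm_num)
      push_cast; linarith
  exact signVec_surjective_of_two_units h3 ρ hρ e₁ e₂ ![1, 0, 0] ![0, 0, 1] hs₁ hs₂ (by decide)

/-! ## §2 The census row `301392cf1`, UNCONDITIONAL -/

/-- **UNCONDITIONAL (A)₂ for the census curve `301392cf1` — ZERO hypotheses, ZERO named facts.** Coates–Sujatha's statement (A) at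
`p = 2`: for every cyclotomic `ℤ₂`-extension of `ℚ` the dual fine Selmer group of the curve over `ℚ_∞` is finitely generated over `ℤ₂`
(`∃ γ D` currency of C1″). KERNEL throughout: the `2`-torsion point field is the TOTALLY REAL cubic field `ℚ(θ)`, `θ³ − θ² − 299θ + 2093 = 0`
(`d = 8372`, `θ` = GEN 6's reduced presentation of `ℚ(P) = ℚ(β)`), with `h = 1` (`classNumber_eq_one_of_root_d8372p`), `2 = 𝔭³`
(Eisenstein translate `θ − 1`), and units of all signatures (§1); the signature genus door `conjA_two_of_genus_adjoin_root_of_signVec_surjective`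
does the rest. UPGRADES `conjA_two_301392cf1 hLim2`. BSD for `301392cf1` is NOT proved by this.
[cite: CoatesSujatha2005, Conj. A and Thm. 3.4] [cite: Greenberg2001IwasawaPastPresent, Prop. 2.1 p. 339] [cite: FrohlichTaylor1990, Ch. V §1 (1.12), p. 164] -/
theorem conjA_two_301392cf1'
    (κ : ZpExtension ℚ 2) (hκ : κ.IsCyclotomic) :
    haveI := isElliptic_301392cf1'
    ∃ (γ : absoluteGaloisGroup ℚ) (D : (⟨0, ((0 : ℤ) : ℚ), 0, ((-2119464084 : ℤ) : ℚ), ((-37556677760852 : ℤ) : ℚ)⟩ : WeierstrassCurve ℚ).FineSelmerDualData κ γ),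
      Module.Finite ℤ_[2] (RestrictScalars ℤ_[2] (IwasawaAlgebra 2) D.X) := by
  haveI := isElliptic_301392cf1'
  obtain ⟨β, hβ⟩ : ∃ β : AlgebraicClosure ℚ, aeval β (Cubic.toPoly ⟨1, ((0 : ℤ) : ℚ), ((-2119464084 : ℤ) : ℚ), ((-37556677760852 : ℤ) : ℚ)⟩) = 0 :=
    IsAlgClosed.exists_aeval_eq_zero _ _ (by rw [Cubic.degree_of_a_ne_zero one_ne_zero]; norm_num)
  have hβ' : β ^ 3 + (0 : AlgebraicClosure ℚ) * β ^ 2 + (-2119464084 : AlgebraicClosure ℚ) * β + (-37556677760852 : AlgebraicClosure ℚ) = 0 := by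
    have := hβ
    simp only [Cubic.toPoly, map_one, one_mul, aeval_add, aeval_mul, aeval_C, aeval_X_pow, aeval_X,
      eq_ratCast, Rat.cast_intCast] at this
    push_cast at this
    linear_combination this
  set θ : AlgebraicClosure ℚ := algebraMap ℚ (AlgebraicClosure ℚ) (21950663899 / 148605093 : ℚ) +
      algebraMap ℚ (AlgebraicClosure ℚ) (356141 / 148605093 : ℚ) * β + algebraMap ℚ (AlgebraicClosure ℚ) (-31 / 297210186 : ℚ) * β ^ 2 with hθdef
  have hθ : aeval θ (Cubic.toPoly ⟨1, ((-1 : ℤ) : ℚ), ((-299 : ℤ) : ℚ), ((2093 : ℤ) : ℚ)⟩) = 0 := by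
    simp only [Cubic.toPoly, map_one, one_mul, aeval_add, aeval_mul, aeval_C, aeval_X_pow, aeval_X, eq_ratCast,
      Rat.cast_intCast]
    rw [hθdef]
    simp only [eq_ratCast]
    push_cast
    linear_combination (((-552064335698258083 : AlgebraicClosure ℚ) / 6563433315660843659478714) + ((13423 : AlgebraicClosure ℚ) / 22083473665538649) * β + ((342251501 : AlgebraicClosure ℚ) / 4375622210440562439652476) * β ^ 2 + ((-29791 : AlgebraicClosure ℚ) / 26253733262643374637914856) * β ^ 3) * hβ'
  have hadj : IntermediateField.adjoin ℚ {θ} = IntermediateField.adjoin ℚ {β} := by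
    apply le_antisymm
    · rw [IntermediateField.adjoin_simple_le_iff, hθdef]
      have hβmem := IntermediateField.mem_adjoin_simple_self ℚ β
      exact add_mem (add_mem (algebraMap_mem _ _) (mul_mem (algebraMap_mem _ _) hβmem))
        (mul_mem (algebraMap_mem _ _) (pow_mem hβmem 2))
    · rw [IntermediateField.adjoin_simple_le_iff]
      have hβeq : β = algebraMap ℚ (AlgebraicClosure ℚ) (-17971 : ℚ) + algebraMap ℚ (AlgebraicClosure ℚ) (-1794 : ℚ) * θ +
          algebraMap ℚ (AlgebraicClosure ℚ) (93 : ℚ) * θ ^ 2 := by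
        rw [hθdef]; simp only [eq_ratCast]; push_cast; linear_combination (((342251501 : AlgebraicClosure ℚ) / 7361157888512883) + ((-29791 : AlgebraicClosure ℚ) / 29444631554051532) * β) * hβ'
      rw [hβeq]
      have hθmem := IntermediateField.mem_adjoin_simple_self ℚ θ
      exact add_mem (add_mem (algebraMap_mem _ _) (mul_mem (algebraMap_mem _ _) hθmem))
        (mul_mem (algebraMap_mem _ _) (pow_mem hθmem 2))
  obtain ⟨P₀, hP₀, hP₀eq⟩ := exists_geomTorsion_two_eq_some_root ((0 : ℤ) : ℚ) ((-2119464084 : ℤ) : ℚ) ((-37556677760852 : ℤ) : ℚ) hβ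
  have hF : IntermediateField.fixedField (MulAction.stabilizer (absoluteGaloisGroup ℚ) P₀) =
      IntermediateField.adjoin ℚ {θ} := by
    rw [fixedField_stabilizer_eq_adjoin_root _ _ _ hβ hP₀eq, hadj]
    -- the two `Algebra ℚ ℚ̄` instance paths agree
    congr 1
  -- `2 = 𝔭³` in `ℚ(θ)`: `θ − 1` is a root of the Eisenstein cubic `X³ + 2X² − 298X + 1794`
  have hroot : aeval (θ + algebraMap ℚ (AlgebraicClosure ℚ) ((-1 : ℤ) : ℚ))
      (Cubic.toPoly ⟨1, ((2 : ℤ) : ℚ), ((-298 : ℤ) : ℚ), ((1794 : ℤ) : ℚ)⟩) = 0 := by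
    have := aeval_cubic_shift_int (p := -1) (q := -299) (r := 2093) (-1) hθ
    norm_num at this ⊢
    exact this
  have hv := existsUnique_two_mem_adjoin_of_eisenstein (p := 2) (q := -298) (r := 1794) (by decide) (by decide) (by decide)
    (by decide) hroot
  rw [adjoin_shift_eq] at hv
  have h3 : Module.finrank ℚ (IntermediateField.adjoin ℚ {θ}) = 3 :=
    finrank_adjoin_eq_three_of_irreducible irreducible_cubic_d8372p hθ
  exact conjA_two_of_genus_adjoin_root_of_signVec_surjective _ hP₀ hθ h3 hF
    (fun {_} => signVec_surjective_cubicField_d8372p hθ)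
    (not_two_dvd_card_classGroup_adjoin_of_forall_cubicField irreducible_cubic_d8372p (classNumber_eq_one_of_root_d8372p) hθ)
    hv κ hκ

end Summit.BirchSwinnertonDyer.BirchSwinnertonDyer.Theorems.AddKatoTwo

end
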